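/-
Copyright (c) 2026 the pub-hodgecm-mathlib formalisation cell (harness21).  Prover seat hodgecm-mathlib-K2E4-p10 (g0), Track B ∕ K2-LIT
(build stream 29), h413 = `stmt-HodgeConjecture-24833`, line `K2_E4_SingularTransferKappaSign`, socket module «ArchLimitConstant», file #10
`sig_K2E4ExplicitArchConstantPhase` — helper §A (complex conjugation and class-function multipliers on orbital integrals).  2026-09-03.
-/
import Literature.NumberTheory.Rogawski1990.ArchimedeanTransfer            -- ★ `ArchSmooth`, `ArchSmooth₂`, `stableOrbitalIntegralRel`, `classOrbitalIntegral`
import Literature.NumberTheory.Automorphic.AutomorphicRepDataConj          -- ★ `IsArchSmooth.star`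
import HarnessLib

/-!
# Socket #10 `sig_K2E4ExplicitArchConstantPhase`, helper §A: orbital integrals under COMPLEX CONJUGATION and under CLASS-FUNCTION MULTIPLIERS
# (Rogawski 1990 §4.1 (4.1.1), §4.3 (4.3.1); Bouaziz 1994 §5.1 «`J_G(χφ) = χ J_G(φ)`»)

Cell `hodgecm-mathlib`, crux H413 = `stmt-HodgeConjecture-24833`, route of record `HCCMUnconditional`; Track B «K2-LIT», line
`Cruxes/H413/Lines/K2_E4_SingularTransferKappaSign.lean`, socket `…SigsArchLimitConstant.sig_K2E4ExplicitArchConstantPhase` (U6, #10).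
THEOREMS ONLY (no `def`, no instance, no notation, no `sorry`); lane `--supports stmt-HodgeConjecture-24833`.

THE ROAD (why these lemmas).  Socket #10 = socket #9 (`sig_K2E4ExplicitArchSingularTransfer`: the archimedean singular transfer identity
`Φ^st_{top}(γ₀ ⊗ 1, a) = c_∞ · a^H(γ_H ⊗ 1)` on every smooth `Δ‴_∞`-pair) + the PHASE «`c_∞ · Δ‴_∞(γ_H ⊗ 1, γ₀ ⊗ 1)` is a non-zero REAL».  The phase
follows from #9 by COMPLEX-CONJUGATION SYMMETRY of the transfer relation: `a ↦ conj ∘ a` commutes with (stable, class) orbital integrals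
(§1–§2 here), and the explicit factor obeys `conj Δ‴_∞(γ_H, γ′) · τ_∞(γ_H)² = Δ‴_∞(γ_H, γ′)` (helper §B), so a `Δ‴_∞`-transfer of `conj ∘ a` has the stable
orbital integrals of `τ_∞² · conj ∘ a^H` near `γ_H ⊗ 1`; the comparison needs class functions to come out of orbital integrals (§3) and `conj` to
preserve the test classes `ArchSmooth`, `ArchSmooth₂` (§4).

* §1 `orbitalIntegral_star`, `classOrbitalIntegral_star` — `Φ(γ, conj ∘ f) = conj Φ(γ, f)` (Bochner `integral_conj`; any measure).
* §2 `stableOrbitalIntegralRel_star` — `Φ^st(γ, conj ∘ f) = conj Φ^st(γ, f)` (`finsum` through the additive equivalence `star`).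
* §3 `orbitalIntegral_mul_of_forall_conj`, `classOrbitalIntegral_mul_of_forall_conj`, `stableOrbitalIntegralRel_mul_of_forall_conj` — a
  conjugation-invariant multiplier `θ`, constant on the `st`-class of `γ`, comes out: `Φ^st(γ, θ · f) = θ(γ) · Φ^st(γ, f)`.
* §4 `ArchSmooth.star`, `ArchSmooth₂.star` — `C_c^∞(G′_∞)` and `C_c^∞(H_∞)` are closed under `f ↦ conj ∘ f` (★ `IsArchSmooth.star`).
HONEST LABEL: count-neutral helper; HC_CM is proved only modulo the 7 printed citations (2 remaining named inputs: hLiu418 = stmt-HodgeConjecture-24832,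
h413 = stmt-HodgeConjecture-24833) until rung 0 closes.

## References
* [Rogawski1990] J. D. Rogawski, *Automorphic Representations of Unitary Groups in Three Variables*, Ann. of Math. Stud. 123 (1990), §4.1 (4.1.1) p. 39,
  §4.3 (4.3.1) p. 43, Prop. 8.2.1 proof pp. 118–119.
* [Bouaziz1994IntegralesOrbitales] A. Bouaziz, *Intégrales orbitales sur les groupes de Lie réductifs*, Ann. Sci. ÉNS (4) 27 (1994), §5.1 p. 588.
* [BorelJacquet1979] A. Borel, H. Jacquet, *Automorphic forms and automorphic representations*, PSPM 33.1 (1979), §4.1.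
-/

set_option autoImplicit false
set_option linter.dupNamespace false

noncomputable section

-- `Classical` is needed to see the Mathlib normed-space instances on `mixedSpace L` (note H5 of ★ `AdelicGLnGlue`)
open MeasureTheory NumberField
open Literature.MeasureTheory.Group
open scoped ComplexConjugate MatrixGroups Classical

namespace Summit.HodgeConjecture.HodgeConjecture.Cruxes.H413.K2E4ExplicitArchConstantPhaseConj

open Literature.NumberTheory.Automorphic Literature.NumberTheory.Rogawski1990

/-! ## §1 `Φ(γ, conj ∘ f) = conj Φ(γ, f)` -/

section Star

variable {G : Type*} [Group G]

/-- **`Φ(γ, conj ∘ f) = conj Φ(γ, f)`** for every measure on `G ⧸ C(γ)` (the orbital integrand of `conj ∘ f` is `conj` of that of `f`;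
Bochner `integral_conj`). [cite: Rogawski1990, §4.1 (4.1.1) p. 39] -/
theorem orbitalIntegral_star (γ : G) [MeasurableSpace (G ⧸ Subgroup.centralizer ({γ} : Set G))] (f : G → ℂ)
    (m : Measure (G ⧸ Subgroup.centralizer ({γ} : Set G))) :
    orbitalIntegral γ (star f) m = conj (orbitalIntegral γ f m) := by
  simp only [orbitalIntegral_eq_integral_descConj]
  rw [← integral_conj]
  refine integral_congr_ae (Filter.Eventually.of_forall fun y => ?_)
  induction y using QuotientGroup.induction_on with
  | H x => rfl

/-- `Φ([γ], conj ∘ f) = conj Φ([γ], f)` for every family of orbital measures. [cite: Rogawski1990, §4.1 (4.1.1) p. 39] -/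
theorem classOrbitalIntegral_star [∀ γ : G, MeasurableSpace (G ⧸ Subgroup.centralizer ({γ} : Set G))] (m : OrbitalMeasureFamily G) (f : G → ℂ)
    (c : ConjClasses G) : classOrbitalIntegral m (star f) c = conj (classOrbitalIntegral m f c) := by
  rw [classOrbitalIntegral_eq, classOrbitalIntegral_eq, orbitalIntegral_star]

/-! ## §2 `Φ^st(γ, conj ∘ f) = conj Φ^st(γ, f)` -/

/-- **`Φ^st(γ, conj ∘ f) = conj Φ^st(γ, f)`** for every «stable conjugacy» relation `st` and every family (no finiteness needed: `conj` is an additive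
EQUIVALENCE, so it commutes with `finsum`). [cite: Rogawski1990, §4.1 (4.1.1) p. 39] -/
theorem stableOrbitalIntegralRel_star [∀ γ : G, MeasurableSpace (G ⧸ Subgroup.centralizer ({γ} : Set G))] (st : G → G → Prop) (m : OrbitalMeasureFamily G)
    (f : G → ℂ) (γ : G) : stableOrbitalIntegralRel st m (star f) γ = conj (stableOrbitalIntegralRel st m f γ) := by
  simp only [stableOrbitalIntegralRel_def, classOrbitalIntegral_star]
  change _ = starAddEquiv (∑ᶠ c ∈ {c : ConjClasses G | st γ (Quotient.out c)}, classOrbitalIntegral m f c)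
  rw [AddEquiv.map_finsum]
  refine finsum_congr fun c => ?_
  rw [AddEquiv.map_finsum]
  rfl

/-! ## §3 A class function comes out of the (stable, class) orbital integral -/

/-- **`Φ(γ, θ · f) = θ(γ) · Φ(γ, f)`** when `θ` is invariant under conjugation BY EVERY element at `γ` (`θ(y γ y⁻¹) = θ γ`): the orbital integrand of
`θ · f` is `θ(γ)` times that of `f` (no integrability needed). [cite: Bouaziz1994IntegralesOrbitales, §5.1 p. 588] [cite: Rogawski1990, §4.1 (4.1.1) p. 39] -/
theorem orbitalIntegral_mul_of_forall_conj (γ : G) [MeasurableSpace (G ⧸ Subgroup.centralizer ({γ} : Set G))] {θ : G → ℂ}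
    (hθ : ∀ y : G, θ (y * γ * y⁻¹) = θ γ) (f : G → ℂ) (m : Measure (G ⧸ Subgroup.centralizer ({γ} : Set G))) :
    orbitalIntegral γ (fun x => θ x * f x) m = θ γ * orbitalIntegral γ f m := by
  simp only [orbitalIntegral_eq_integral_descConj]
  rw [← integral_const_mul]
  refine integral_congr_ae (Filter.Eventually.of_forall fun y => ?_)
  induction y using QuotientGroup.induction_on with
  | H x => simp only [descConj_mk, hθ x]

/-- `Φ([γ], θ · f) = θ(out [γ]) · Φ([γ], f)` for a conjugation-invariant `θ`. [cite: Bouaziz1994IntegralesOrbitales, §5.1 p. 588] -/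
theorem classOrbitalIntegral_mul_of_forall_conj [∀ γ : G, MeasurableSpace (G ⧸ Subgroup.centralizer ({γ} : Set G))] (m : OrbitalMeasureFamily G)
    {θ : G → ℂ} (hθ : ∀ x y : G, θ (y * x * y⁻¹) = θ x) (f : G → ℂ) (c : ConjClasses G) :
    classOrbitalIntegral m (fun x => θ x * f x) c = θ (Quotient.out c) * classOrbitalIntegral m f c := by
  rw [classOrbitalIntegral_eq, classOrbitalIntegral_eq, orbitalIntegral_mul_of_forall_conj _ (hθ _)]

/-- **`Φ^st(γ, θ · f) = θ(γ) · Φ^st(γ, f)`** when `θ` is conjugation invariant AND constant on the `st`-class of `γ` (`st γ x → θ x = θ γ`).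
[cite: Bouaziz1994IntegralesOrbitales, §5.1 p. 588] [cite: Rogawski1990, §4.1 (4.1.1) p. 39] -/
theorem stableOrbitalIntegralRel_mul_of_forall_conj [∀ γ : G, MeasurableSpace (G ⧸ Subgroup.centralizer ({γ} : Set G))] (st : G → G → Prop)
    (m : OrbitalMeasureFamily G) {θ : G → ℂ} (hθ : ∀ x y : G, θ (y * x * y⁻¹) = θ x) (γ : G) (hst : ∀ x, st γ x → θ x = θ γ) (f : G → ℂ) :
    stableOrbitalIntegralRel st m (fun x => θ x * f x) γ = θ γ * stableOrbitalIntegralRel st m f γ := by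
  simp only [stableOrbitalIntegralRel_def]
  rw [← smul_eq_mul, smul_finsum]
  refine finsum_congr fun c => ?_
  rw [smul_finsum]
  refine finsum_congr fun hc => ?_
  rw [classOrbitalIntegral_mul_of_forall_conj m hθ, hst _ hc, smul_eq_mul]

end Star

/-! ## §4 `conj` preserves the archimedean test classes -/

section Smooth

variable (L : Type) [Field L] [NumberField L] [IsCMField L] (N : ℕ) (H : Matrix (Fin N) (Fin N) L)

/-- **`C_c^∞(U(H)(L⁺ ⊗ ℝ))` is closed under complex conjugation**: `ArchSmooth L N H a → ArchSmooth L N H (conj ∘ a)` (the witness `conj ∘ φ`: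
continuous, same support, right-exp-smooth by ★ `IsArchSmooth.star`). [cite: BorelJacquet1979, §4.1] -/
theorem ArchSmooth.star {a : UnitaryGroup.arch (↥(maximalRealSubfield L)) L (IsCMField.complexConj L) N H → ℂ} (ha : ArchSmooth L N H a) :
    ArchSmooth L N H (star a) := by
  obtain ⟨φ, hφc, hφs, hφsm, hφa⟩ := ha
  refine ⟨fun g => conj (φ g), Complex.continuous_conj.comp hφc, ?_, hφsm.star, fun k => ?_⟩
  · rw [hasCompactSupport_def] at hφs ⊢
    refine hφs.of_isClosed_subset isClosed_closure (closure_mono fun g hg => ?_)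
    rw [Function.mem_support] at hg ⊢
    exact fun h0 => hg (by rw [h0, map_zero])
  · rw [Pi.star_apply, hφa k]
    rfl

/-- **`C_c^∞(H_∞)` is closed under complex conjugation**: `ArchSmooth₂ L aH → ArchSmooth₂ L (conj ∘ aH)`. [cite: BorelJacquet1979, §4.1] -/
theorem ArchSmooth₂.star
    {aH : UnitaryGroup.arch (↥(maximalRealSubfield L)) L (IsCMField.complexConj L) 2 (Matrix.of fun i j : Fin 2 => if i.val + j.val + 1 = 2 then (1 : L) else 0) ×
        UnitaryGroup.arch (↥(maximalRealSubfield L)) L (IsCMField.complexConj L) 1 (Matrix.of fun i j : Fin 1 => if i.val + j.val + 1 = 1 then (1 : L) else 0) → ℂ}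
    (ha : ArchSmooth₂ L aH) : ArchSmooth₂ L (star aH) := by
  obtain ⟨φ, hφc, hφs, hφsm, hφa⟩ := ha
  refine ⟨fun g => conj (φ g), Complex.continuous_conj.comp hφc, ?_, hφsm.star, fun k => ?_⟩
  · rw [hasCompactSupport_def] at hφs ⊢
    refine hφs.of_isClosed_subset isClosed_closure (closure_mono fun g hg => ?_)
    rw [Function.mem_support] at hg ⊢
    exact fun h0 => hg (by rw [h0, map_zero])
  · rw [Pi.star_apply, hφa k]
    rfl

end Smooth

end Summit.HodgeConjecture.HodgeConjecture.Cruxes.H413.K2E4ExplicitArchConstantPhaseConj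

end
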